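import Mathlib
import Literature.NumberTheory.LFunctions.WeilExplicit
import Literature.NumberTheory.LFunctions.WeilGroundState
import Literature.Analysis.Complex.VitaliConvergence
import Summits.RiemannHypothesis.RiemannHypothesis.Theorems.WeilGroundStateGroundStatesConvergeToXiStubLocallyUniformOfPointwise
import HarnessLib

/-!
# Stub `stub_weakLimit_mellin_locallyUniform` (M2) of line `Sketch` for crux `WeilGroundState.GroundStatesConvergeToXi`
(item stmt-RiemannHypothesis-1527, route route-RiemannHypothesis-WeilGroundState; registered
skeleton `Summits/RiemannHypothesis/RiemannHypothesis/Cruxes/GroundStatesConvergeToXi/Lines/Sketch.lean`;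
helper file, `--supports`)

## What is proved

`stub_weakLimit_mellin_locallyUniform`: let `u_k` be ground states of Weil's truncated quadratic
form (`IsWeilGroundState (a k) (u k)`) and `c_k` scalars such that the renormalised ground states
`c_k u_k` are TIGHT in every weighted `L¹(e^{b|t|} dt)`, `b < 1/2`
(`∫ ‖c_k u_k(t)‖ e^{b|t|} dt ≤ M_b` uniformly in `k`), and let `V` be ANY function holomorphic on
the open critical strip `U = {s | 0 < Re s < 1}` such that `F_k := c_k · weilMellin (u_k) → V`
pointwise at every real point of the segment `(0, 1)`. Then `F_k → V` LOCALLY UNIFORMLY on `U`.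

This is the Vitali/Montel transfer of the line with a GENERAL holomorphic target `V` (the weak
limit's Mellin transform `weilMellin v`, supplied by stub M1); the landed
`stub_locallyUniform_of_pointwise`
(`Summits/…/WeilGroundStateGroundStatesConvergeToXiStubLocallyUniformOfPointwise.lean`) is the
case `V = ξ`. A curried form `tendstoLocallyUniformlyOn_weilMellin_of_tight_pointwise` is also
provided.

## Proof

1. The strip `U` is open and convex (hence preconnected); each `F_k` is entire
   (`IsWeilGroundState.differentiable_weilMellin`).
2. Local boundedness from tightness: for `z ∈ U` put `s₀ = |Re z − 1/2| < 1/2`,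
   `b = (s₀ + 1/2)/2`, `r = b − s₀`; for `w ∈ ball z r` one has `|Re w − 1/2| < b`, so
   `‖F_k(w)‖ ≤ ∫ ‖c_k u_k(t)‖ e^{(Re w − 1/2) t} dt ≤ ∫ ‖c_k u_k(t)‖ e^{b|t|} dt ≤ M_b`.
3. Pointwise convergence on `(1/2, 1) ⊆ (0, 1)` is pushed forward along `ℝ → ℂ` to
   "frequently near `1/2` in `𝓝[≠] (1/2 : ℂ)`", so VITALI's theorem
   (`Literature.Analysis.Complex.exists_tendstoLocallyUniformlyOn_of_frequently_tendsto`) gives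
   a holomorphic locally uniform limit `f` on `U`.
4. `f = V` on `(0, 1)` by uniqueness of limits, hence on `U` by the identity theorem
   (`AnalyticOnNhd.eqOn_of_preconnected_of_frequently_eq`; `V` is analytic on the OPEN set `U`
   by `DifferentiableOn.analyticOnNhd`), and `TendstoLocallyUniformlyOn.congr_right` concludes.

Mathlib + the `Literature` files above only; no named fact is used; no definitions.

## References

* E. C. Titchmarsh, *The Theory of Functions*, 2nd ed., §5.21 (Vitali's convergence theorem).
-/

set_option linter.dupNamespace false

noncomputable section

open MeasureTheory Complex Filter Set Metric
open scoped Real Topology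

namespace Summit.RiemannHypothesis.RiemannHypothesis.Theorems.GroundStatesConvergeToXi

open Literature.NumberTheory.LFunctions

/-! ## Step 2: local bounds from tightness -/

/-- Pointwise bound on the weighted integrand: if `|Re w − 1/2| ≤ b` then
`‖c · u(t) · e^{(w − 1/2) t}‖ ≤ ‖c · u(t)‖ e^{b |t|}`. [folklore] -/
private theorem wlml_norm_integrand_le {w : ℂ} {b : ℝ} (hw : |w.re - 1 / 2| ≤ b) (c v : ℂ)
    (t : ℝ) : ‖c * (v * cexp ((w - 1 / 2) * t))‖ ≤ ‖c * v‖ * Real.exp (b * |t|) := by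
  rw [← mul_assoc, norm_mul (c * v), Complex.norm_exp]
  refine mul_le_mul_of_nonneg_left (Real.exp_le_exp.2 ?_) (norm_nonneg _)
  have hre : ((w - 1 / 2) * (t : ℂ)).re = (w.re - 1 / 2) * t := by simp [sub_re, mul_re]
  rw [hre]
  calc (w.re - 1 / 2) * t ≤ |(w.re - 1 / 2) * t| := le_abs_self _
    _ = |w.re - 1 / 2| * |t| := abs_mul _ _
    _ ≤ b * |t| := mul_le_mul_of_nonneg_right hw (abs_nonneg _)

/-- The weighted `L¹` bound controls the renormalised Mellin transform: if `u` is a ground state,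
`|Re w − 1/2| ≤ b` and `∫ ‖c u(t)‖ e^{b|t|} dt ≤ M`, then `‖c · weilMellin u w‖ ≤ M`. [folklore] -/
private theorem wlml_norm_const_mul_weilMellin_le {a : ℝ} {u : ℝ → ℂ}
    (hu : IsWeilGroundState a u) (c : ℂ) {w : ℂ} {b M : ℝ} (hw : |w.re - 1 / 2| ≤ b)
    (hM : ∫ t, ‖c * u t‖ * Real.exp (b * |t|) ≤ M) :
    ‖c * weilMellin u w‖ ≤ M := by
  have hint : Integrable fun t : ℝ => c * (u t * cexp ((w - 1 / 2) * t)) :=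
    (hu.integrable_mul_cexp (w - 1 / 2)).const_mul c
  have hdom : Integrable fun t : ℝ => ‖c * u t‖ * Real.exp (b * |t|) := by
    have h1 : Integrable fun t : ℝ => u t * ((Real.exp (b * |t|) : ℝ) : ℂ) :=
      hu.integrable_mul_continuous (by fun_prop)
    refine ((h1.const_mul c).norm).congr (Eventually.of_forall fun t => ?_)
    simp only [← mul_assoc, norm_mul (c * u t), Complex.norm_real, Real.norm_eq_abs,
      abs_of_pos (Real.exp_pos _)]
  rw [weilMellin, ← integral_const_mul]
  calc ‖∫ t : ℝ, c * (u t * cexp ((w - 1 / 2) * t))‖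
      ≤ ∫ t : ℝ, ‖c * (u t * cexp ((w - 1 / 2) * t))‖ := norm_integral_le_integral_norm _
    _ ≤ ∫ t : ℝ, ‖c * u t‖ * Real.exp (b * |t|) :=
        integral_mono hint.norm hdom fun t => wlml_norm_integrand_le hw c (u t) t
    _ ≤ M := hM

/-- **Local boundedness from tightness.** Under the uniform weighted `L¹` bounds, the sequence
`F_k = c_k · weilMellin (u_k)` is uniformly bounded on a ball around every point of the open
critical strip. [folklore] -/
private theorem wlml_locallyBounded_of_tight {a : ℕ → ℝ} {u : ℕ → ℝ → ℂ} {c : ℕ → ℂ}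
    (hu : ∀ k, IsWeilGroundState (a k) (u k))
    (htight : ∀ b : ℝ, b < 1 / 2 → ∃ M : ℝ, ∀ k, ∫ t, ‖c k * u k t‖ * Real.exp (b * |t|) ≤ M) :
    ∀ z ∈ {s : ℂ | 0 < s.re ∧ s.re < 1}, ∃ M : ℝ, ∃ r > 0, ∀ n,
      ∀ w ∈ ball z r ∩ {s : ℂ | 0 < s.re ∧ s.re < 1}, ‖c n * weilMellin (u n) w‖ ≤ M := by
  intro z hz
  obtain ⟨hz0, hz1⟩ := hz
  set s₀ : ℝ := |z.re - 1 / 2| with hs₀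
  have hs₀lt : s₀ < 1 / 2 := by
    rw [hs₀, abs_lt]
    constructor <;> linarith
  set b : ℝ := (s₀ + 1 / 2) / 2 with hb
  have hb_lt : b < 1 / 2 := by rw [hb]; linarith
  have hs₀b : s₀ < b := by rw [hb]; linarith
  obtain ⟨M, hM⟩ := htight b hb_lt
  refine ⟨M, b - s₀, sub_pos.2 hs₀b, fun n w hw => ?_⟩
  have hwz : ‖w - z‖ < b - s₀ := by
    have h1 := hw.1
    rwa [Metric.mem_ball, dist_eq_norm] at h1
  have hwb : |w.re - 1 / 2| ≤ b := by
    have e : w.re - 1 / 2 = (w - z).re + (z.re - 1 / 2) := by simp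
    rw [e]
    refine (abs_add_le _ _).trans ?_
    have h2 : |(w - z).re| ≤ ‖w - z‖ := abs_re_le_norm (w - z)
    linarith
  exact wlml_norm_const_mul_weilMellin_le (hu n) (c n) hwb (hM n)

/-! ## Steps 1, 3, 4: Vitali and the identity theorem -/

/-- **Locally uniform convergence of the renormalised Mellin transforms to a general holomorphic
target (curried form; RH-free, Vitali).** For ground states `u_k` and scalars `c_k`: tightness in
every weighted `L¹(e^{b|t|})`, `b < 1/2`, makes `F_k := c_k · weilMellin (u_k)` (entire,
`IsWeilGroundState.differentiable_weilMellin`) locally bounded on the open strip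
`U = {0 < Re s < 1}` (`|F_k(s)| ≤ ∫|c_k u_k| e^{|Re s − 1/2||t|} ≤ M_b`); pointwise convergence
to a function `V` holomorphic on `U` along the real segment `(0,1)` accumulates at `1/2`, so
Vitali (`Literature.Analysis.Complex.exists_tendstoLocallyUniformlyOn_of_frequently_tendsto`)
gives a locally uniform limit `f` on `U`, `f = V` on `(0,1)` hence on the (connected) strip by
the identity theorem, and `TendstoLocallyUniformlyOn.congr_right` concludes. [folklore] -/
theorem tendstoLocallyUniformlyOn_weilMellin_of_tight_pointwise
    {a : ℕ → ℝ} {u : ℕ → ℝ → ℂ} {c : ℕ → ℂ} {V : ℂ → ℂ}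
    (hu : ∀ k, IsWeilGroundState (a k) (u k))
    (htight : ∀ b : ℝ, b < 1 / 2 → ∃ M : ℝ, ∀ k, ∫ t, ‖c k * u k t‖ * Real.exp (b * |t|) ≤ M)
    (hV : DifferentiableOn ℂ V {s : ℂ | 0 < s.re ∧ s.re < 1})
    (hpt : ∀ σ : ℝ, σ ∈ Ioo (0 : ℝ) 1 →
      Tendsto (fun k => c k * weilMellin (u k) σ) atTop (𝓝 (V σ))) :
    TendstoLocallyUniformlyOn (fun k s => c k * weilMellin (u k) s) V atTop
      {s : ℂ | 0 < s.re ∧ s.re < 1} := by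
  set U : Set ℂ := {s : ℂ | 0 < s.re ∧ s.re < 1} with hUdef
  -- Step 1: the strip is open and connected, the approximants are holomorphic on it
  have hUo : IsOpen U :=
    (isOpen_lt continuous_const Complex.continuous_re).inter
      (isOpen_lt Complex.continuous_re continuous_const)
  have hUc : IsPreconnected U :=
    ((convex_halfSpace_re_gt (0 : ℝ)).inter (convex_halfSpace_re_lt 1)).isPreconnected
  have hFd : ∀ k, DifferentiableOn ℂ (fun s => c k * weilMellin (u k) s) U := fun k =>
    ((hu k).differentiable_weilMellin.const_mul (c k)).differentiableOn
  -- Step 2: local boundedness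
  have hb : ∀ z ∈ U, ∃ M : ℝ, ∃ r > 0, ∀ n, ∀ w ∈ ball z r ∩ U,
      ‖c n * weilMellin (u n) w‖ ≤ M := wlml_locallyBounded_of_tight hu htight
  -- real points of the segment `(0, 1)` lie in `U`
  have hIU : ∀ σ : ℝ, σ ∈ Ioo (0 : ℝ) 1 → (σ : ℂ) ∈ U := fun σ hσ =>
    ⟨by simpa only [ofReal_re] using hσ.1, by simpa only [ofReal_re] using hσ.2⟩
  -- a base point `σ₀ ∈ (0, 1)` and the push-forward `𝓝[>] σ₀ → 𝓝[≠] (σ₀ : ℂ)`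
  obtain ⟨σ₀, hσ₀⟩ : ∃ σ₀ : ℝ, σ₀ ∈ Ioo (0 : ℝ) 1 := ⟨1 / 2, by norm_num, by norm_num⟩
  have hz₀ : (σ₀ : ℂ) ∈ U := hIU σ₀ hσ₀
  have htend : Tendsto (fun s : ℝ => (s : ℂ)) (𝓝[>] σ₀) (𝓝[≠] (σ₀ : ℂ)) :=
    continuous_ofReal.continuousWithinAt.tendsto_nhdsWithin fun s hs =>
      fun h => (ne_of_gt hs) (ofReal_injective h)
  have hev : ∀ᶠ s : ℝ in 𝓝[>] σ₀, s ∈ Ioo (0 : ℝ) 1 :=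
    mem_nhdsWithin_of_mem_nhds (isOpen_Ioo.mem_nhds hσ₀)
  -- Step 3: Vitali
  have hS : ∃ᶠ z in 𝓝[≠] (σ₀ : ℂ), ∃ l : ℂ,
      Tendsto (fun n => c n * weilMellin (u n) z) atTop (𝓝 l) :=
    htend.frequently (hev.mono fun σ hσ => ⟨V σ, hpt σ hσ⟩).frequently
  obtain ⟨f, hf, hlim⟩ :=
    Literature.Analysis.Complex.exists_tendstoLocallyUniformlyOn_of_frequently_tendsto hUo hUc
      hFd hb hz₀ hS
  -- Step 4: the limit is `V` (identity theorem on the open connected strip)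
  have hfU : EqOn f V U := by
    have hfreq : ∃ᶠ z in 𝓝[≠] (σ₀ : ℂ), f z = V z := by
      refine htend.frequently (hev.mono fun σ hσ => ?_).frequently
      exact tendsto_nhds_unique (hlim.tendsto_at (hIU σ hσ)) (hpt σ hσ)
    exact (hf.analyticOnNhd hUo).eqOn_of_preconnected_of_frequently_eq
      (hV.analyticOnNhd hUo) hUc hz₀ hfreq
  exact hlim.congr_right hfU

/-- **Stub `stub_weakLimit_mellin_locallyUniform` (M2; RH-free, Vitali), registered uncurried
form.** For ground states `u_k` (`IsWeilGroundState (a k) (u k)`) and scalars `c_k` with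
`c_k u_k` tight in every weighted `L¹(e^{b|t|} dt)`, `b < 1/2`, and any `V` holomorphic on the
open critical strip `{0 < Re s < 1}` with `c_k · weilMellin (u_k) (σ) → V σ` for every real
`σ ∈ (0, 1)`: `c_k · weilMellin (u_k) → V` locally uniformly on the strip (local boundedness from
tightness, Vitali's convergence theorem, identity theorem; this is
`tendstoLocallyUniformlyOn_weilMellin_of_tight_pointwise`). [folklore] -/
theorem stub_weakLimit_mellin_locallyUniform :
    ∀ (a : ℕ → ℝ) (u : ℕ → ℝ → ℂ) (c : ℕ → ℂ) (V : ℂ → ℂ),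
      (∀ k, IsWeilGroundState (a k) (u k)) →
      (∀ b : ℝ, b < 1 / 2 → ∃ M : ℝ, ∀ k, ∫ t, ‖c k * u k t‖ * Real.exp (b * |t|) ≤ M) →
      DifferentiableOn ℂ V {s : ℂ | 0 < s.re ∧ s.re < 1} →
      (∀ σ : ℝ, σ ∈ Ioo (0 : ℝ) 1 →
        Tendsto (fun k => c k * weilMellin (u k) σ) atTop (𝓝 (V σ))) →
      TendstoLocallyUniformlyOn (fun k s => c k * weilMellin (u k) s) V atTop
        {s : ℂ | 0 < s.re ∧ s.re < 1} :=
  fun _ _ _ _ hu htight hV hpt =>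
    tendstoLocallyUniformlyOn_weilMellin_of_tight_pointwise hu htight hV hpt

end Summit.RiemannHypothesis.RiemannHypothesis.Theorems.GroundStatesConvergeToXi

end
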